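import Literature.AlgebraicGeometry.Resolution.Principalization
import Literature.AlgebraicGeometry.Resolution.AlterationsBoundaryDivisor
import Literature.AlgebraicGeometry.Resolution.KollarOrderReduction
import Literature.AlgebraicGeometry.Resolution.SemiStableFibreDimension
import Literature.AlgebraicGeometry.Resolution.QuadraticTransformsUFD
import Mathlib.AlgebraicGeometry.FunctionField
import HarnessLib

/-!
# The non-locally-principal locus of an ideal sheaf (Cossart–Piltant 2008, Prop. 4.2 (i))

Topic: `Literature/AlgebraicGeometry/Resolution`. First brick under the named fact
`CossartPiltant2019Principalization` (`Principalization.lean`; Cossart–Piltant, J. Algebra 529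
(2019), Prop. 4.4 = arXiv v1 Prop. 4.3, proved there by reference to [CoP1] = Cossart–Piltant,
J. Algebra 320 (2008), Prop. 4.2): the centres of the principalizing blowing ups are regular
integral subschemes
`𝒴(j) ⊆ {y ∈ 𝒳(j) | 𝓘𝒪_{𝒳(j),y}` is not locally principal`}` ([CoP1] Prop. 4.2 (i), PDF p. 7),
and the first paragraph of the printed proof (PDF p. 7: "`J := H⁻¹ I ⊆ 𝒪_X` is such that `V(J)`
has codimension at least two in `X` … `Σ` is a closed subset of `X` of dimension zero or one")
rests on two facts about this locus which this file PROVES over Mathlib and the tree: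

* `nonPrincipalLocus J : Closeds X` — **the set of points at which `J` is not locally
  principal is closed** (local principality, `IsLocallyPrincipalAt` of `Principalization.lean`,
  is an open condition by definition); `mem_nonPrincipalLocus_iff`,
  `nonPrincipalLocus_eq_bot_iff` (`= ∅` iff `J` is locally principal);
* `isLocallyPrincipalAt_iff_isPrincipal_stalkIdeal` — **on a locally Noetherian scheme, `J` is
  locally principal at `x` iff the stalk `J_x = J𝒪_{X,x}` is a principal ideal** — so the
  vendored neighbourhood condition of `IsRegularCentreBlowupSeq` agrees with the printed stalk
  condition "`𝓘𝒪_{𝒳(j),y}` is not locally principal" (Nakayama picks a section whose germ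
  generates, `exists_mem_span_singleton_eq_of_span_eq`; it generates `J` on a neighbourhood,
  `exists_ideal_eq_span_singleton_of_stalkIdeal_eq`, both `AlterationsBoundaryDivisor.lean`);
* `isLocallyPrincipalAt_of_not_mem_support`, `nonPrincipalLocus_le_support` — off `V(J)` the
  ideal is the unit ideal; `not_mem_support_genericPoint`, `genericPoint_not_mem_nonPrincipalLocus`,
  `nonPrincipalLocus_ne_top` — a non-zero ideal sheaf on an integral scheme is locally
  principal at the generic point (so a centre as in Prop. 4.2 (i) is never all of `𝒳(j)`);
* `isLocallyPrincipalAt_of_ringKrullDim_stalk_le_one` (a regular local ring of dimension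
  `≤ 1` is a principal ideal ring, `isPrincipalIdealRing_of_ringKrullDim_le_one` of
  `QuadraticTransformsUFD.lean`) and `one_lt_ringKrullDim_stalk_of_mem_nonPrincipalLocus`:
  **on a regular locally Noetherian scheme every ideal sheaf is locally principal in
  codimension `≤ 1`**, i.e. the
  non-locally-principal locus has codimension `≥ 2` ([CoP1], proof of Prop. 4.2: "`V(J)` has
  codimension at least two", the divisorial part `H` being invertible);
* `topologicalKrullDim_le_of_forall_height_le` — a closed subset all of whose points have
  height `≤ n` (chains of specialisations below them of length `≤ n`) has dimension `≤ n`;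
  `one_lt_coheight_of_mem_nonPrincipalLocus`, `height_le_one_of_mem_nonPrincipalLocus` and
  **`topologicalKrullDim_nonPrincipalLocus_le_one`: on a regular locally Noetherian scheme of
  dimension `≤ 3` the non-locally-principal locus of every ideal sheaf has dimension `≤ 1`**
  ([CoP1], proof of Prop. 4.2: "`Σ` is a closed subset of `X` of dimension zero or one"), via
  Mathlib's `dim 𝒪_{X,x} = coheight x` (Stacks 02IZ) and `height x + coheight x ≤ dim X`;
* `nonPrincipalLocus_comap_subset` — the non-locally-principal locus of an inverse image
  `J𝒪_{X'} = J.comap f` lies over that of `J` (`IsLocallyPrincipalAt.comap`,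
  `KollarOrderReduction.lean`);
* `IsRegularCentreBlowupSeq.cons'` — the constructor of `IsRegularCentreBlowupSeq` with the
  centre condition phrased as `Y ≤ nonPrincipalLocus (J.comap σ)`.

## Sources

* V. Cossart, O. Piltant, *Resolution of singularities of threefolds in positive
  characteristic. I*, J. Algebra 320 (2008) 1051–1082, Prop. 4.2 and its proof (PDF pp. 7–8).
  [CossartPiltant2008]
* V. Cossart, O. Piltant, J. Algebra 529 (2019) 268–535, Prop. 4.4 (arXiv:1412.0868 v1:
  Prop. 4.3, p. 50). [CossartPiltant2019]
* The Stacks Project, Tags 01WR (locally principal closed subschemes), 02IZ (`dim 𝒪_{X,x}` is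
  the codimension of `x`). [StacksProject]

## What is NOT here

The divisorial part `I = H · J` on a regular (locally factorial) scheme, and everything about
the order `ord_x J` along the locus (the idealistic exponent `(J, μ)` of [CoP1]) — later bricks.
-/

noncomputable section

open CategoryTheory CategoryTheory.Limits AlgebraicGeometry TopologicalSpace IsLocalRing

namespace Literature.AlgebraicGeometry.Resolution

universe u

open Scheme.IdealSheafData

variable {X : Scheme.{u}}

/-! ## The non-locally-principal locus is closed -/

/-- Local principality spreads over the affine open on which a generator is given. [folklore] -/
theorem isLocallyPrincipalAt_of_ideal_eq_span {J : X.IdealSheafData} {U : X.affineOpens}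
    {f : Γ(X, U)} (hJ : J.ideal U = Ideal.span {f}) {y : X} (hy : y ∈ (U : X.Opens)) :
    IsLocallyPrincipalAt J y :=
  ⟨U, hy, f, hJ⟩

/-- **The locally principal locus of an ideal sheaf is open** (by definition: a generator on an
affine open neighbourhood serves all points of that neighbourhood). [folklore] -/
theorem isOpen_setOf_isLocallyPrincipalAt (J : X.IdealSheafData) :
    IsOpen {x : X | IsLocallyPrincipalAt J x} := by
  rw [isOpen_iff_forall_mem_open]
  rintro x ⟨U, hxU, f, hf⟩
  exact ⟨(U : X.Opens), fun y hy => isLocallyPrincipalAt_of_ideal_eq_span hf hy, U.1.isOpen, hxU⟩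

/-- **The non-locally-principal locus** `{x ∈ X | J𝒪_{X,x} is not locally principal}` of the
ideal sheaf `J`, as a closed subset of `X` — the locus containing the centres `𝒴(j)` of
Cossart–Piltant's principalization ([CoP1] Prop. 4.2 (i); CP 2019 Prop. 4.4 (i)).
[cite: CossartPiltant2008, Prop. 4.2 (i)] -/
def nonPrincipalLocus (J : X.IdealSheafData) : Closeds X :=
  ⟨{x : X | IsLocallyPrincipalAt J x}ᶜ, (isOpen_setOf_isLocallyPrincipalAt J).isClosed_compl⟩

/-- Membership in the non-locally-principal locus. [folklore] -/
@[simp] theorem mem_nonPrincipalLocus_iff (J : X.IdealSheafData) (x : X) :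
    x ∈ nonPrincipalLocus J ↔ ¬ IsLocallyPrincipalAt J x :=
  Iff.rfl

/-- The underlying set of the non-locally-principal locus. [folklore] -/
theorem coe_nonPrincipalLocus (J : X.IdealSheafData) :
    (nonPrincipalLocus J : Set X) = {x : X | ¬ IsLocallyPrincipalAt J x} :=
  rfl

/-- The non-locally-principal locus is empty iff the ideal sheaf is locally principal.
[folklore] -/
theorem nonPrincipalLocus_eq_bot_iff (J : X.IdealSheafData) :
    nonPrincipalLocus J = ⊥ ↔ IsLocallyPrincipal J := by
  rw [← SetLike.coe_set_eq, coe_nonPrincipalLocus, Closeds.coe_bot,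
    Set.eq_empty_iff_forall_notMem]
  exact forall_congr' fun x => not_not

/-- The constructor of `IsRegularCentreBlowupSeq` with the centre condition phrased through
`nonPrincipalLocus`: a sequence may be extended by a blowing up along a regular integral
closed subset `Y ≤ nonPrincipalLocus (J𝒪_{S'})`. [cite: CossartPiltant2019, Prop. 4.4 (i) (arXiv v1: Prop. 4.3)] -/
theorem IsRegularCentreBlowupSeq.cons' {S'' S' S : Scheme.{u}} {τ : S'' ⟶ S'} {σ : S' ⟶ S}
    {J : S.IdealSheafData} {Y : Closeds S'} (hσ : IsRegularCentreBlowupSeq σ J)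
    (hint : IsIntegral (vanishingIdeal Y).subscheme)
    (hreg : Scheme.IsRegular (vanishingIdeal Y).subscheme)
    (hY : Y ≤ nonPrincipalLocus (J.comap σ)) (hτ : IsBlowup τ (vanishingIdeal Y)) :
    IsRegularCentreBlowupSeq (τ ≫ σ) J :=
  IsRegularCentreBlowupSeq.cons τ σ J Y hσ hint hreg (fun _ hy => hY hy) hτ

/-! ## Local principality is read on the stalk -/

/-- If `J` is locally principal at `x` then the stalk `J_x ⊆ 𝒪_{X,x}` is a principal ideal
(generated by the germ of a local generator). [folklore] -/
theorem IsLocallyPrincipalAt.isPrincipal_stalkIdeal {J : X.IdealSheafData} {x : X}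
    (h : IsLocallyPrincipalAt J x) : (stalkIdeal J x).IsPrincipal := by
  obtain ⟨U, hxU, f, hf⟩ := h
  refine ⟨(X.presheaf.germ U x hxU).hom f, ?_⟩
  change stalkIdeal J x = Ideal.span {(X.presheaf.germ U x hxU).hom f}
  rw [stalkIdeal_eq_map_germ J U hxU, hf, Ideal.map_span, Set.image_singleton]

/-- **Spreading out a principal stalk.** On a locally Noetherian scheme, if the stalk
`J_x = J𝒪_{X,x}` is a principal ideal then `J` is locally principal at `x`: a generator may be
taken to be the germ of a section of `J` (Nakayama), which then generates `J` on an affine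
open neighbourhood. [folklore] -/
theorem isLocallyPrincipalAt_of_isPrincipal_stalkIdeal [IsLocallyNoetherian X]
    {J : X.IdealSheafData} {x : X} (h : (stalkIdeal J x).IsPrincipal) :
    IsLocallyPrincipalAt J x := by
  obtain ⟨U, hU, hxU, -⟩ :=
    exists_isAffineOpen_mem_and_subset (X := X) (x := x) (U := ⊤) (Opens.mem_top x)
  obtain ⟨g, hg⟩ := h
  replace hg : stalkIdeal J x = Ideal.span {g} := hg
  -- a section `i ∈ J(U)` whose germ generates `J_x`
  obtain ⟨i, hi, hIi⟩ : ∃ i ∈ J.ideal ⟨U, hU⟩,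
      stalkIdeal J x = Ideal.span {(X.presheaf.germ U x hxU).hom i} := by
    by_cases hg0 : g = 0
    · exact ⟨0, zero_mem _, by rw [hg, hg0, map_zero]⟩
    · have hspan : Ideal.span ((X.presheaf.germ U x hxU).hom '' (J.ideal ⟨U, hU⟩)) =
          Ideal.span {g} := by
        rw [← hg, stalkIdeal_eq_map_germ J ⟨U, hU⟩ hxU, Ideal.map]
      obtain ⟨_, ⟨i, hi, rfl⟩, hgen⟩ := exists_mem_span_singleton_eq_of_span_eq hg0 hspan
      exact ⟨i, hi, by rw [hgen, hg]⟩
  obtain ⟨V, hVU, hxV, hIV⟩ :=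
    exists_ideal_eq_span_singleton_of_stalkIdeal_eq J ⟨U, hU⟩ hxU i hi hIi
  exact ⟨V, hxV, X.presheaf.map (homOfLE hVU).op i, hIV⟩

/-- **Local principality is a stalk condition** on locally Noetherian schemes: `J` is locally
principal at `x` (one generator on an affine open neighbourhood) iff `J𝒪_{X,x}` is a principal
ideal of `𝒪_{X,x}` — the form in which [CoP1] Prop. 4.2 (i) / CP 2019 Prop. 4.4 (i) print the
condition on the centres. [cite: CossartPiltant2008, Prop. 4.2 (i)] -/
theorem isLocallyPrincipalAt_iff_isPrincipal_stalkIdeal [IsLocallyNoetherian X]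
    (J : X.IdealSheafData) (x : X) :
    IsLocallyPrincipalAt J x ↔ (stalkIdeal J x).IsPrincipal :=
  ⟨IsLocallyPrincipalAt.isPrincipal_stalkIdeal, isLocallyPrincipalAt_of_isPrincipal_stalkIdeal⟩

/-- On a locally Noetherian scheme, the non-locally-principal locus is the set of points whose
stalk ideal `J𝒪_{X,x}` is not principal. [cite: CossartPiltant2008, Prop. 4.2 (i)] -/
theorem coe_nonPrincipalLocus_eq_setOf_not_isPrincipal [IsLocallyNoetherian X]
    (J : X.IdealSheafData) :
    (nonPrincipalLocus J : Set X) = {x : X | ¬ (stalkIdeal J x).IsPrincipal} := by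
  ext x
  rw [coe_nonPrincipalLocus, Set.mem_setOf_eq, Set.mem_setOf_eq,
    isLocallyPrincipalAt_iff_isPrincipal_stalkIdeal]

/-! ## Off the support, and at the generic point -/

/-- Off its support an ideal sheaf is locally the unit ideal, hence locally principal: a
section of `J(U)` not vanishing at `x` is a unit on its basic open. [folklore] -/
theorem isLocallyPrincipalAt_of_not_mem_support {J : X.IdealSheafData} {x : X}
    (hx : x ∉ J.support) : IsLocallyPrincipalAt J x := by
  obtain ⟨U, hU, hxU, -⟩ :=
    exists_isAffineOpen_mem_and_subset (X := X) (x := x) (U := ⊤) (Opens.mem_top x)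
  rw [mem_support_iff_of_mem (I := J) (U := ⟨U, hU⟩) hxU, Scheme.mem_zeroLocus_iff] at hx
  push Not at hx
  obtain ⟨f, hfJ, hxf⟩ := hx
  refine ⟨X.affineBasicOpen f, hxf, 1, ?_⟩
  rw [Ideal.span_singleton_one, eq_top_iff, ← J.map_ideal_basicOpen]
  have hu : IsUnit (X.presheaf.map (homOfLE (X.basicOpen_le f)).op f) := by
    have := hU.isLocalization_basicOpen f
    exact IsLocalization.Away.algebraMap_isUnit (S := Γ(X, X.basicOpen f)) f
  exact (Ideal.eq_top_of_isUnit_mem _ (Ideal.mem_map_of_mem _ hfJ) hu).ge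

/-- The non-locally-principal locus lies in the support `V(J)`. [folklore] -/
theorem nonPrincipalLocus_le_support (J : X.IdealSheafData) : nonPrincipalLocus J ≤ J.support :=
  fun _ hx => not_imp_comm.mp isLocallyPrincipalAt_of_not_mem_support hx

/-- On an integral scheme the generic point is not in the support of a non-zero ideal sheaf
(the support is a proper closed subset). [folklore] -/
theorem not_mem_support_genericPoint [IsIntegral X] {J : X.IdealSheafData} (hJ : J ≠ ⊥) :
    genericPoint X ∉ J.support := by
  intro h
  apply hJ
  rw [← support_eq_top_iff, ← top_le_iff]
  intro x _
  have := (genericPoint_spec X).mem_closed_set_iff J.support.isClosed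
  exact (this.mp h) (Set.mem_univ x)

/-- **A non-zero ideal sheaf on an integral scheme is locally principal at the generic point.**
[folklore] -/
theorem genericPoint_not_mem_nonPrincipalLocus [IsIntegral X] {J : X.IdealSheafData}
    (hJ : J ≠ ⊥) : genericPoint X ∉ nonPrincipalLocus J := fun h =>
  h (isLocallyPrincipalAt_of_not_mem_support (not_mem_support_genericPoint hJ))

/-- Hence the non-locally-principal locus of a non-zero ideal sheaf on an integral scheme is a
proper closed subset — a centre as in [CoP1] Prop. 4.2 (i) is never the whole scheme.
[cite: CossartPiltant2008, Prop. 4.2 (i)] -/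
theorem nonPrincipalLocus_ne_top [IsIntegral X] {J : X.IdealSheafData} (hJ : J ≠ ⊥) :
    nonPrincipalLocus J ≠ ⊤ := fun h =>
  genericPoint_not_mem_nonPrincipalLocus hJ (by rw [h]; trivial)

/-! ## Regular points of codimension at most one -/

/-- **On a locally Noetherian scheme every ideal sheaf is locally principal at a regular point
of codimension `≤ 1`**: its local ring, a regular local ring of dimension `≤ 1`, is a principal
ideal ring (`isPrincipalIdealRing_of_ringKrullDim_le_one`, `QuadraticTransformsUFD.lean`).
[folklore] -/
theorem isLocallyPrincipalAt_of_ringKrullDim_stalk_le_one [IsLocallyNoetherian X]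
    (J : X.IdealSheafData) {x : X} [IsRegularLocalRing (X.presheaf.stalk x)]
    (hdim : ringKrullDim (X.presheaf.stalk x) ≤ 1) : IsLocallyPrincipalAt J x :=
  haveI := isPrincipalIdealRing_of_ringKrullDim_le_one (R := X.presheaf.stalk x) hdim
  isLocallyPrincipalAt_of_isPrincipal_stalkIdeal (IsPrincipalIdealRing.principal _)

/-- **The non-locally-principal locus of an ideal sheaf on a regular locally Noetherian scheme
has codimension `≥ 2`**: at each of its points the local ring has dimension `> 1` ([CoP1],
proof of Prop. 4.2: after removing the invertible divisorial part, "`V(J)` has codimension at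
least two in `X`"). [cite: CossartPiltant2008, proof of Prop. 4.2] -/
theorem one_lt_ringKrullDim_stalk_of_mem_nonPrincipalLocus [IsLocallyNoetherian X]
    (hX : Scheme.IsRegular X) {J : X.IdealSheafData} {x : X} (hx : x ∈ nonPrincipalLocus J) :
    1 < ringKrullDim (X.presheaf.stalk x) := by
  haveI := hX x
  by_contra h
  exact hx (isLocallyPrincipalAt_of_ringKrullDim_stalk_le_one J (not_lt.mp h))

/-! ## Dimension count: the locus has dimension at most one in a threefold -/

/-- **Points of height `≤ n` only ⇒ dimension `≤ n`.** If every point of a closed subset `Z` of a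
scheme `X` has height `≤ n` for the specialisation order of `X` (Mathlib: `a ≤ b ↔ b ⤳ a`, so
the points below `x` are its specialisations), then `dim Z ≤ n`: a chain of irreducible closed
subsets of `Z` is a chain of irreducible closed subsets of `X` inside `Z`, i.e. (generic
points, `irreducibleSetEquivPoints`) a chain of points of `Z`. [folklore] -/
theorem topologicalKrullDim_le_of_forall_height_le {Z : Set X} (hZ : IsClosed Z) (n : ℕ)
    (h : ∀ x ∈ Z, Order.height x ≤ n) : topologicalKrullDim Z ≤ n := by
  rw [topologicalKrullDim, Order.krullDim_eq_iSup_height]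
  refine iSup_le fun T => ?_
  -- `T ⊆ Z` irreducible closed; its closure `T'` in `X` (equal to `T`) is irreducible closed
  set T' : IrreducibleCloseds X := IrreducibleCloseds.map Subtype.val continuous_subtype_val T
    with hT'
  have hmono : StrictMono (IrreducibleCloseds.map (Subtype.val : Z → X) continuous_subtype_val) :=
    IrreducibleCloseds.map_strictMono_of_isInducing Topology.IsInducing.subtypeVal
  have h1 : Order.height T ≤ Order.height T' :=
    Order.height_le_height_apply_of_strictMono _ hmono T
  -- the generic point `t'` of `T'` lies in `Z` and has the same height as `T'`
  have hT'Z : (T' : Set X) ⊆ Z := by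
    rw [hT', IrreducibleCloseds.coe_map]
    exact closure_minimal (by rintro _ ⟨z, -, rfl⟩; exact z.2) hZ
  letI := specializationOrder X
  have h2 : Order.height T' ≤ Order.height (irreducibleSetEquivPoints (α := X) T') :=
    Order.height_le_height_apply_of_strictMono _ (irreducibleSetEquivPoints (α := X)).strictMono T'
  have hmem : irreducibleSetEquivPoints (α := X) T' ∈ Z := by
    apply hT'Z
    have hgen := T'.isIrreducible.isGenericPoint_genericPoint_closure
    rw [T'.isClosed.closure_eq] at hgen
    exact hgen.mem
  have h3 := h _ hmem
  exact_mod_cast h1.trans (h2.trans h3)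

/-- `height x + coheight x ≤ dim X` for every point `x` of a scheme (a chain below `x` and a chain
above `x` concatenate). [folklore] -/
theorem coe_height_add_coheight_le_topologicalKrullDim (x : X) :
    ((Order.height x + Order.coheight x : ℕ∞) : WithBot ℕ∞) ≤ topologicalKrullDim X := by
  haveI : Nonempty X := ⟨x⟩
  rw [topologicalKrullDim_eq_krullDim_carrier,
    Order.krullDim_eq_iSup_height_add_coheight_of_nonempty]
  exact WithBot.coe_le_coe.mpr (le_iSup (fun a : X => Order.height a + Order.coheight a) x)

/-- At a point of the non-locally-principal locus of an ideal sheaf on a regular locally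
Noetherian scheme, the codimension (`coheight x = dim 𝒪_{X,x}`, Stacks 02IZ) is `> 1`.
[cite: StacksProject, Tag 02IZ] -/
theorem one_lt_coheight_of_mem_nonPrincipalLocus [IsLocallyNoetherian X]
    (hX : Scheme.IsRegular X) {J : X.IdealSheafData} {x : X} (hx : x ∈ nonPrincipalLocus J) :
    (1 : ℕ∞) < Order.coheight x := by
  have h := one_lt_ringKrullDim_stalk_of_mem_nonPrincipalLocus hX hx
  rw [ringKrullDim_stalk_eq_coheight] at h
  exact_mod_cast h

/-- **In dimension `≤ 3`, points of the non-locally-principal locus have height `≤ 1`** (they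
are closed points or generic points of curves): `height x + coheight x ≤ 3` and
`coheight x ≥ 2`. [cite: CossartPiltant2008, proof of Prop. 4.2] -/
theorem height_le_one_of_mem_nonPrincipalLocus [IsLocallyNoetherian X] (hX : Scheme.IsRegular X)
    (hdim : topologicalKrullDim X ≤ 3) {J : X.IdealSheafData} {x : X}
    (hx : x ∈ nonPrincipalLocus J) : Order.height x ≤ 1 := by
  have h1 : (1 : ℕ∞) < Order.coheight x := one_lt_coheight_of_mem_nonPrincipalLocus hX hx
  have h2 : Order.height x + Order.coheight x ≤ 3 := by
    have := (coe_height_add_coheight_le_topologicalKrullDim x).trans hdim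
    rwa [← WithBot.coe_ofNat, WithBot.coe_le_coe] at this
  have hc : Order.coheight x ≠ ⊤ := by
    intro h
    rw [h, add_top, top_le_iff] at h2
    exact ENat.coe_ne_top 3 h2
  have hh : Order.height x ≠ ⊤ := by
    intro h
    rw [h, top_add, top_le_iff] at h2
    exact ENat.coe_ne_top 3 h2
  obtain ⟨c, hc'⟩ := ENat.ne_top_iff_exists.mp hc
  obtain ⟨a, ha'⟩ := ENat.ne_top_iff_exists.mp hh
  rw [← hc', ← ha'] at h2
  rw [← hc'] at h1
  rw [← ha']
  have h1' : 1 < c := by exact_mod_cast h1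
  have h2' : a + c ≤ 3 := by exact_mod_cast h2
  exact_mod_cast (show a ≤ 1 by omega)

/-- **[CoP1], proof of Prop. 4.2: "`Σ` is a closed subset of `X` of dimension zero or one."**
On a regular locally Noetherian scheme of dimension `≤ 3`, the non-locally-principal locus of
every ideal sheaf has dimension `≤ 1`. [cite: CossartPiltant2008, proof of Prop. 4.2] -/
theorem topologicalKrullDim_nonPrincipalLocus_le_one [IsLocallyNoetherian X]
    (hX : Scheme.IsRegular X) (hdim : topologicalKrullDim X ≤ 3) (J : X.IdealSheafData) :
    topologicalKrullDim (nonPrincipalLocus J) ≤ 1 := by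
  have := topologicalKrullDim_le_of_forall_height_le (nonPrincipalLocus J).isClosed 1
    fun x hx => height_le_one_of_mem_nonPrincipalLocus hX hdim hx
  exact_mod_cast this

/-! ## Inverse images -/

/-- The non-locally-principal locus of the inverse image ideal sheaf `J𝒪_{X} = J.comap f`
lies over the non-locally-principal locus of `J`. [folklore] -/
theorem nonPrincipalLocus_comap_subset {Y : Scheme.{u}} (f : X ⟶ Y) (J : Y.IdealSheafData) :
    (nonPrincipalLocus (J.comap f) : Set X) ⊆ f ⁻¹' (nonPrincipalLocus J : Set Y) :=
  fun _ hx h => hx (h.comap f)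

end Literature.AlgebraicGeometry.Resolution

end
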